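import Summits.KontsevichZagierPeriods.Zeta5Search.LaiSweepShard

/-!
# `κ₃` sweep certificate — shard file 010 of 127 (shards 70–76 of 889)

HONEST FRAMING. Systematic search; no irrationality claim unless certified. This file only checks,
by `decide +kernel`, shards 70–76 of the order-cell sweep of the `κ₃` point `(74, 2180, 444; δ74)`
(engine `LaiSweepEngine`, soundness `LaiSweepJump/Free/Eval/Shard/Kappa3`; a shard is `⟨regime, n,
p, q, p', q', Lo, Up⟩`: `n` cells from `p/q` to `p'/q'` with integer rate sums in `[Lo, Up]`, `K =
128`, `D = 2^40`). It draws NO conclusion: only the capstone `LaiKappa3SweepCert`, which needs all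
127 shard files, does. Kernel cost of this file ≈ 560 cells × 0.3 s.
-/

namespace Summit.KontsevichZagierPeriods.Zeta5Search.Sweep

set_option maxHeartbeats 100000000 in
/-- Shard 70: 80 cells of regime A from `49/2586` to `25/1303`.
[cite: Lai2024BallRivoal, §4 Lemma 4.3] -/
theorem shard070 :
    Shard.check 128 (2^40)
      ⟨false, 80, 49, 2586, 25, 1303, 82372588095510, 82403995975180⟩ = true := by
  decide +kernel

set_option maxHeartbeats 100000000 in
/-- Shard 71: 80 cells of regime A from `25/1303` to `5/257`.
[cite: Lai2024BallRivoal, §4 Lemma 4.3] -/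
theorem shard071 :
    Shard.check 128 (2^40)
      ⟨false, 80, 25, 1303, 5, 257, 89986156565741, 90028118688458⟩ = true := by
  decide +kernel

set_option maxHeartbeats 100000000 in
/-- Shard 72: 80 cells of regime A from `5/257` to `43/2187`.
[cite: Lai2024BallRivoal, §4 Lemma 4.3] -/
theorem shard072 :
    Shard.check 128 (2^40)
      ⟨false, 80, 5, 257, 43, 2187, 67060448154929, 67084126680710⟩ = true := by
  decide +kernel

set_option maxHeartbeats 100000000 in
/-- Shard 73: 80 cells of regime A from `43/2187` to `5/251`.
[cite: Lai2024BallRivoal, §4 Lemma 4.3] -/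
theorem shard073 :
    Shard.check 128 (2^40)
      ⟨false, 80, 43, 2187, 5, 251, 81729350597317, 81761341693056⟩ = true := by
  decide +kernel

set_option maxHeartbeats 100000000 in
/-- Shard 74: 80 cells of regime A from `5/251` to `44/2185`.
[cite: Lai2024BallRivoal, §4 Lemma 4.3] -/
theorem shard074 :
    Shard.check 128 (2^40)
      ⟨false, 80, 5, 251, 44, 2185, 66749922827509, 66775374611321⟩ = true := by
  decide +kernel

set_option maxHeartbeats 100000000 in
/-- Shard 75: 80 cells of regime A from `44/2185` to `26/1277`.
[cite: Lai2024BallRivoal, §4 Lemma 4.3] -/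
theorem shard075 :
    Shard.check 128 (2^40)
      ⟨false, 80, 44, 2185, 26, 1277, 67108537733757, 67133112420055⟩ = true := by
  decide +kernel

set_option maxHeartbeats 100000000 in
/-- Shard 76: 80 cells of regime A from `26/1277` to `9/437`.
[cite: Lai2024BallRivoal, §4 Lemma 4.3] -/
theorem shard076 :
    Shard.check 128 (2^40)
      ⟨false, 80, 26, 1277, 9, 437, 69783250669963, 69810155988907⟩ = true := by
  decide +kernel

/-- The checked shards of this file, in order. [folklore] -/
def shards010 : List (CheckedShard 128 (2^40)) :=
  [⟨_, shard070⟩, ⟨_, shard071⟩, ⟨_, shard072⟩, ⟨_, shard073⟩, ⟨_, shard074⟩,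
    ⟨_, shard075⟩, ⟨_, shard076⟩]

end Summit.KontsevichZagierPeriods.Zeta5Search.Sweep
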